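import Summits.BirchSwinnertonDyer.BirchSwinnertonDyer.Theorems.EdixhovenFibreFiveSevenStarredOptimalManinUnitFiveSevenCdtThm1
import Summits.BirchSwinnertonDyer.BirchSwinnertonDyer.Theses.TeichmullerTwistDescent
import HarnessLib

set_option autoImplicit false
-- the sub-problem namespace `Summit.BirchSwinnertonDyer.BirchSwinnertonDyer` duplicates a component by design (D-0017)
set_option linter.dupNamespace false

/-!
# Route TeichmullerTwistDescent, crux PSMU `PrincipalSeriesOptimalManinUnit` (stmt-BirchSwinnertonDyer-22638), closed by name

PSMU: for `W/ℚ` globally minimal, additive at a prime `p ≥ 5` with `E[p]` irreducible, whose isogeny class has a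
`(G)`-ordinary member and an `Iₙ*`-free member at `p`, and `D` a lattice-optimal parametrisation datum at any level
`N` (`Λ_W = c · Λ_f`): `p ∤ c(D)`.

Only the clauses «additive at `p ≥ 5`» and «lattice-optimal» are used: the landed conditional closer
`TeichmullerTwistDescentOfCDTInt.principalSeriesOptimalManinUnit_of_CDTInt` (LEAD edix-p1 g36; it is
`EdixhovenFibreFiveSevenOfCDTInt.not_dvd_c_of_CDTInt`, p811415: `p² ∣ N` at an additive prime, then `|c| = 1` at
a level with an odd square factor by the integer `c`-division chain) takes exactly the printed Calegari–Dimitrov–Tang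
Theorem 1.0.1 as hypothesis; that hypothesis is now the tree theorem
`calegariDimitrovTang2025_unboundedDenominators_holds` (p826028, line `cdt_thm1` of crux K★ of route
EdixhovenFibreFiveSeven).  Composing the two proves the item BY NAME.

BSD is not proved by this; Manin's conjecture is not proved by this (the statement is the additive principal-series
cell at `p ≥ 5` only); no leaf or rung closes. [cite: CalegariDimitrovTang2025, Thm. 1.0.1] [cite: EdixhovenManin1991, Thm. 3]
-/

namespace Summit.BirchSwinnertonDyer.BirchSwinnertonDyer.Theorems

/-- **Crux PSMU `PrincipalSeriesOptimalManinUnit` (stmt-BirchSwinnertonDyer-22638), proved by name**: `p ∤ c` at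
every lattice-optimal datum of a globally minimal curve additive at `p ≥ 5` in the principal-series typing — from
CDT Theorem 1.0.1 (`calegariDimitrovTang2025_unboundedDenominators_holds`) through
`EdixhovenFibreFiveSevenOfCDTInt.not_dvd_c_of_CDTInt` (the proof of
`TeichmullerTwistDescentOfCDTInt.principalSeriesOptimalManinUnit_of_CDTInt`, inlined); the irreducibility, `(G)`-ordinary
and `Iₙ*` clauses are idle.  BSD is NOT proved by this. [cite: CalegariDimitrovTang2025, Thm. 1.0.1] -/
theorem TeichmullerTwistDescent.PrincipalSeriesOptimalManinUnit_proof :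
    Summit.BirchSwinnertonDyer.BirchSwinnertonDyer.Theses.TeichmullerTwistDescent.PrincipalSeriesOptimalManinUnit := by
  -- the proof of `TeichmullerTwistDescentOfCDTInt.principalSeriesOptimalManinUnit_of_CDTInt`, inlined so that this
  -- file imports the route file directly and no other module of its cone
  intro W _ _ p _ N _ D hp5 hadd _hirr _hG _hI hlat
  exact EdixhovenFibreFiveSevenOfCDTInt.not_dvd_c_of_CDTInt calegariDimitrovTang2025_unboundedDenominators_holds
    D hp5 hadd hlat

end Summit.BirchSwinnertonDyer.BirchSwinnertonDyer.Theorems
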